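import Summits.BirchSwinnertonDyer.BirchSwinnertonDyer.Theorems.ClassRecordThreeShimuraKolyvaginImageInputs
import Literature.NumberTheory.EllipticCurves.HeegnerPointsKolyvaginPrimaryCebotarevProofs
import HarnessLib

/-!
# McCallum's Cor. 3.2 (Kolyvagin primes with prescribed local orders, level `p^M`) from the three
# image inputs instead of `ρ̄_{E,p}` onto — hence for EVERY irreducible `E[3]` on the locus of
# crux 19616 (cell `bsd-stepL`, seat `bsd-stepL-shim3b` g4; helper for the record item
# stmt-BirchSwinnertonDyer-19616 `ShimuraKolyvaginOrderBoundAtThree`, stub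
# `stub_orderBound_irredNonSurjAtThree`, and the (T4″)@3 corner)

HONEST FRAMING (programme file §HONESTY, verbatim): «no tranche here proves BSD; ARM L moves the
LITERAL column of an r ≤ 1 census into the kernel-proved-modulo-named-print column; ARM P changes what
«named print» is worth. The residue (4.31 %) and every SUMMIT-BEARING rung (S0–S3) stay theorem-bound
and are staffed by the 22 routes, not by this programme.» THEOREMS ONLY (no definition, no named fact,
no `sorry`); nothing here is a BSD class theorem; no census label moves; item 19616 stays ASIDE.

## What this file does

The tree's `Literature.NumberTheory.EllipticCurves.exists_kolyvaginPrime_gt_pow`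
(`HeegnerPointsKolyvaginPrimaryCebotarevProofs`; McCallum 1991, Prop. 3.1 and Cor. 3.2 at level
`p^M`, from the Čebotarev density theorem) takes `hρ : ρ̄_{E,p}` ONTO and uses it — as its own
docstring says («the image of `Γ_K` is used on `E_p` only (`KolyvaginImage.*`) … nothing is
assumed about `ρ_{E,p^M}`») — only to produce three properties of the `Γ_K`-module `E(K̄)[p]`:
`hz` (some `z` acts as `−1`), `hS` (simplicity), `hCe` (scalar commutant).

* §1 `exists_kolyvaginPrime_gt_pow_of_image` — the SAME statement with `hρ` replaced by the three
  inputs `(hz) (hS) (hCe)`; the proof is the tree's, verbatim, minus the four lines of Step A that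
  read them off `hρ` (adapted from `HeegnerPointsKolyvaginPrimaryCebotarevProofs.exists_kolyvaginPrime_gt_pow`;
  every lemma it calls is the tree's). `McCallum1991_cor_3_2_pow_of_image` is the packaged form
  (McCallum's printed hypotheses: non-zero classes, `aᵢcᵢ = 0`, `p^{Mᵢ} = ord cᵢ`), again the tree's
  wrapper verbatim.
* §2 **`McCallum1991_cor_3_2_pow_three_of_irr`** — at `p = 3`, for EVERY `E/ℚ` with `E[3]`
  IRREDUCIBLE (onto or not: images `GL₂(𝔽₃)`, `N(C_s)`, `N(C_ns)`) and `K` imaginary quadratic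
  with the splitting hypotheses of the registered stub `stub_orderBound_irredNonSurjAtThree` of
  item 19616 (`N_E = N`; `N⁻ = ∏ S` unramified; `N⁺` and `3` split), McCallum's Cor. 3.2 holds at
  every level `3^M` UNCONDITIONALLY: the three inputs come from `ShimuraKolyvaginImageInputs.kolyvaginImageInputs_three`
  (seat g3's `hz` + this seat's `hS`, `hC` via Gross's disjointness `(d_K, 3N) = 1`), the Weil
  pairing and the Čebotarev density theorem are PROVED in the tree
  (`WeierstrassCurve.exists_weilPairing_holds`, `Automorphic.chebotarev_artinRep_of_galoisSide`).
  This is the image-uniformity of the Čebotarev step asserted in print by Matar–Nekovář 2019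
  (Prop. 5.26 (2), `ρ̄` irreducible) and Cha 2005 (Lemmas 22–23), now a kernel theorem at `p = 3`.

NOT claimed: Kolyvagin classes, Euler-system relations, any order bound; the stub is untouched.

References: [McCallumLMS1991] §3 Prop. 3.1, Cor. 3.2; [GrossLMS1991] §9; [TateGCFT1967] §2.4;
[SilvermanAEC2009] III.8.1, VII.4.1; [MatarNekovar2019] Prop. 5.26 (2); [Cha2005] Lemmas 22–23.
-/

set_option autoImplicit false
set_option linter.dupNamespace false -- the Theorems namespace repeats the summit name, as in every sibling

noncomputable section

open scoped Classical Pointwise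

open WeierstrassCurve NumberField IsDedekindDomain Field Literature.NumberTheory
  Literature.NumberTheory.EllipticCurves Literature.NumberTheory.GaloisRepresentations

universe u

namespace Summit.BirchSwinnertonDyer.BirchSwinnertonDyer.Theorems.ShimuraKolyvaginCebotarevOfImage

/-! ## §1. McCallum Cor. 3.2 at level `p^M` from the image inputs `hz`, `hS`, `hCe` -/

section Main

variable {W : WeierstrassCurve ℚ} {K : Type u} [Field K] [NumberField K]

/-- **One Kolyvagin prime of level `p^M` above any bound, with prescribed local orders, from
the three image inputs** (McCallum 1991, Prop. 3.1 and Cor. 3.2 with their proofs, PDF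
pp. 279–280; Gross 1991, §9).  Identical to the tree's `exists_kolyvaginPrime_gt_pow` except that
the hypothesis `ρ̄_{E,p}` onto is replaced by what that proof extracts from it: `hz` (some
`z ∈ Γ_K` acts as `−1` on `E(K̄)[p]`), `hS` (`E(K̄)[p]` is a simple `Γ_K`-module),
`hCe` (its `Γ_K`-commutant is scalar).  Conclusion as there: for every `b` a prime `ℓ > b`,
`ℓ ∤ N d_K`, `ℓ ≠ p`, `(ℓ)` prime in `𝓞 K`, `Frob(ℓ) = Frob(∞)` in `Gal(K(E_{p^M})/ℚ)`, and
`ord c_{i,λ} = p^{N_i}` exactly at `λ ∋ ℓ`.  Proof: the tree's, verbatim (adapted from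
`Literature/NumberTheory/EllipticCurves/HeegnerPointsKolyvaginPrimaryCebotarevProofs.lean`,
`exists_kolyvaginPrime_gt_pow`, Step A shortened). [cite: McCallumLMS1991, §3 Cor. 3.2 (proof, with Prop. 3.1)] -/
theorem exists_kolyvaginPrime_gt_pow_of_image (hC : Automorphic.chebotarev_artinRep) {N : ℕ}
    [NeZero N] [W.IsElliptic] (hK : IsImaginaryQuadratic K) {p : ℕ} (hp : p.Prime) (hp2 : p ≠ 2)
    (hz : ∃ z : absoluteGaloisGroup K, ∀ t : geomTorsion (W.baseChange K) p, z • t = -t)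
    (hS : (W.baseChange K).HasIrreducibleModPGaloisRep p)
    (hCe : ∀ f : geomTorsion (W.baseChange K) p →+ geomTorsion (W.baseChange K) p,
      (∀ (g : absoluteGaloisGroup K) (t : geomTorsion (W.baseChange K) p), f (g • t) = g • f t) →
        ∃ k : ℤ, ∀ t, f t = k • t)
    (hW : W.exists_weilPairing p) {M : ℕ} (hM : 1 ≤ M)
    {c : K ≃ₐ[ℚ] K} (hc : c ≠ 1) {r : ℕ}
    (cs : Fin r → galH1Torsion (W.baseChange K) ((p ^ M : ℕ) : ℤ))
    (hτ : ∀ i, ∃ e : ℤ, (e = 1 ∨ e = -1) ∧ conjAct W c ((p ^ M : ℕ) : ℤ) (cs i) = e • cs i)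
    (ex : Fin r → ℕ) (hex : ∀ i, ((p : ℤ) ^ ex i) • cs i = 0)
    (hind : ∀ a : Fin r → ℤ, ∑ i, a i • cs i = 0 → ∀ i, ((p : ℤ) ^ ex i) ∣ a i)
    (Nv : Fin r → ℕ) (hNe : ∀ i, Nv i ≤ ex i) (hNM : ∀ i, Nv i ≤ M) (b : ℕ) :
    ∃ ℓ : ℕ, b < ℓ ∧ ℓ.Prime ∧ ¬ ℓ ∣ N ∧ ¬ ((ℓ : ℤ) ∣ NumberField.discr K) ∧ ℓ ≠ p ∧
      (Ideal.span {(ℓ : 𝓞 K)}).IsPrime ∧ FrobEqFrobInfty W K (p ^ M) ℓ ∧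
      ∀ i, ∀ v : HeightOneSpectrum (𝓞 K), (ℓ : 𝓞 K) ∈ v.asIdeal →
        (((p : ℤ) ^ Nv i) • cs i ∈
            (W.baseChange K).torsionLocalKer (v.adicCompletion K) ((p ^ M : ℕ) : ℤ) ∧
          (Nv i ≠ 0 → ((p : ℤ) ^ (Nv i - 1)) • cs i ∉
            (W.baseChange K).torsionLocalKer (v.adicCompletion K) ((p ^ M : ℕ) : ℤ))) := by
  classical
  haveI : Fact p.Prime := ⟨hp⟩
  haveI : Algebra.IsQuadraticExtension ℚ K := ⟨hK.1⟩
  haveI : IsTotallyComplex K := hK.2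
  have hp0 : (p : ℤ) ≠ 0 := by exact_mod_cast hp.ne_zero
  have hn0 : ((p ^ M : ℕ) : ℤ) ≠ 0 := by exact_mod_cast pow_ne_zero M hp.ne_zero
  have hpn : (p : ℤ) ∣ ((p ^ M : ℕ) : ℤ) := by
    rw [Nat.cast_pow]; exact dvd_pow_self _ (by omega)
  have hodd : Odd p := hp.odd_of_ne_two hp2
  -- ### Step A: complex conjugation, the involutive lift, the image of `Γ_K` on `E_p`
  obtain ⟨c₀, hc₀⟩ := exists_isComplexConjugation (Rat.castHom ℝ)
  set t : AlgebraicClosure K ≃+* AlgebraicClosure K :=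
    (absGaloisTransport (K := ℚ) (L := K) c₀).toRingEquiv with ht_def
  have ht : IsLiftOfAut c t :=
    RatClosure.isLiftOfAut_absGaloisTransport_of_isImaginaryQuadratic hK hc hc₀
  have hinv : ∀ x, t (t x) = x := fun x ↦
    RatClosure.absGaloisTransport_absGaloisTransport_of_sq_eq_one hc₀.sq_eq_one x
  -- (the image inputs `hz`, `hS`, `hCe` are hypotheses here; in the tree's
  -- `exists_kolyvaginPrime_gt_pow` they are read off `ρ̄_{E,p}` onto via `KolyvaginImage.*`)
  obtain ⟨z, hz⟩ := hz
  -- eigenvectors of `τ` on `E(K̄)[p]`, transported from `E(ℚ̄)[p]`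
  obtain ⟨⟨vPlus, hvPlus0, hvPlus⟩, ⟨vMinus, hvMinus0, hvMinus⟩⟩ :=
    RatClosure.exists_eigenvectors W hc₀ hW hp2
  set θ := RatClosure.torsionEquiv (K := K) W p with hθ
  have hePlus : ht.torsionMap W p (θ vPlus) = θ vPlus := by
    rw [← RatClosure.torsionEquiv_smul_of_lift W ht c₀ (fun _ ↦ rfl) p vPlus, hvPlus]
  have heMinus : ht.torsionMap W p (θ vMinus) = -θ vMinus := by
    rw [← RatClosure.torsionEquiv_smul_of_lift W ht c₀ (fun _ ↦ rfl) p vMinus, hvMinus, map_neg]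
  have hPlus0 : θ vPlus ≠ 0 := fun h ↦ hvPlus0 (θ.injective (by rw [h, map_zero]))
  have hMinus0 : θ vMinus ≠ 0 := fun h ↦ hvMinus0 (θ.injective (by rw [h, map_zero]))
  -- ### Step A': the level-`p^M` inputs
  have hz' : ∀ P : geomTorsion (W.baseChange K) ((p ^ M : ℕ) : ℤ), z ^ p ^ (M - 1) • P = -P :=
    smul_eq_neg_geomTorsion_pow (W.baseChange K) hodd hM hz
  obtain ⟨u, hu⟩ := exists_two_mul_zsmul_eq_of_odd (W.baseChange K) (n := p ^ M) hodd.pow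
  obtain ⟨ePlus, hePlus', hPlus0'⟩ := ht.exists_eigenvector_pow W hinv hp hp2 hM (ν := 1)
    (Or.inl rfl) (e₁ := θ vPlus) (by rw [one_smul]; exact hePlus) hPlus0
  obtain ⟨eMinus, heMinus', hMinus0'⟩ := ht.exists_eigenvector_pow W hinv hp hp2 hM (ν := -1)
    (Or.inr rfl) (e₁ := θ vMinus) (by rw [neg_one_zsmul]; exact heMinus) hMinus0
  rw [one_smul] at hePlus'
  rw [neg_one_zsmul] at heMinus'
  have hkill : ∀ P : geomTorsion (W.baseChange K) ((p ^ M : ℕ) : ℤ), ((p : ℤ) ^ M) • P = 0 :=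
    fun P ↦ by
    apply Subtype.ext
    rw [AddSubgroupClass.coe_zsmul, ZeroMemClass.coe_zero]
    have := (mem_geomTorsion_iff (W.baseChange K) _ (P : geomPoints (W.baseChange K))).mp P.2
    exact_mod_cast this
  choose ν hν using hτ
  -- ### Step B: the choice of `ρ` (McCallum (2) and Prop. 3.1 at level `p^M`)
  obtain ⟨ρ, hρT, hρ⟩ := ht.exists_h1Eval_conj_mul_order W hinv hp hpn hS hCe hz' hu hePlus'
    heMinus' (hkill ePlus) (hkill eMinus) hPlus0' hMinus0' (fun i ↦ (hν i).1) (fun i ↦ (hν i).2)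
    ex hex hind Nv hNe hNM
  -- ### Step C: the finite exceptional set of places of `ℚ`
  have hbad : ((W.baseChange K).badPlaces (𝓞 K)).Finite :=
    (W.baseChange K).finite_badPlaces_holds (𝓞 K)
  choose T hTfin hT using fun i ↦
    exists_finite_forall_mem_unramifiedKer (W.baseChange K) hn0 (cs i)
  set B : Finset ℕ := {p} ∪ N.primeFactors ∪ (NumberField.discr K).natAbs.primeFactors ∪
    Finset.range (b + 1) with hB
  set S₁ : Set (HeightOneSpectrum (𝓞 ℚ)) := {v | ∃ q ∈ B, q.Prime ∧ (q : 𝓞 ℚ) ∈ v.asIdeal}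
    with hS₁
  set S₂ : Set (HeightOneSpectrum (𝓞 ℚ)) := {v | ¬ Algebra.IsUnramifiedIn (𝓞 K) v.asIdeal}
    with hS₂
  set S₃ : Set (HeightOneSpectrum (𝓞 ℚ)) :=
    (fun w : HeightOneSpectrum (𝓞 K) ↦ w.under (𝓞 ℚ)) ''
      ((W.baseChange K).badPlaces (𝓞 K) ∪ ⋃ i, T i) with hS₃
  have hS₁fin : S₁.Finite := by
    have : S₁ ⊆ ⋃ q ∈ (B.filter Nat.Prime), {v | (q : 𝓞 ℚ) ∈ v.asIdeal} := by
      intro v ⟨q, hqB, hq, hqv⟩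
      simp only [Set.mem_iUnion, Finset.mem_filter]
      exact ⟨q, ⟨hqB, hq⟩, hqv⟩
    refine Set.Finite.subset (Set.Finite.biUnion (Finset.finite_toSet _) fun q hq ↦ ?_) this
    rw [Finset.coe_filter, Set.mem_setOf_eq] at hq
    have hsub : {v : HeightOneSpectrum (𝓞 ℚ) | (q : 𝓞 ℚ) ∈ v.asIdeal}.Subsingleton :=
      fun v hv v' hv' ↦ HeightOneSpectrum.eq_of_natCast_mem_rat hq.2 hv hv'
    exact hsub.finite
  have hS₂fin : S₂.Finite := finite_setOf_not_isUnramifiedIn ℚ K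
  have hS₃fin : S₃.Finite :=
    (hbad.union (Set.finite_iUnion fun i ↦ hTfin i)).image _
  set S := S₁ ∪ S₂ ∪ S₃ with hSdef
  have hSfin : S.Finite := (hS₁fin.union hS₂fin).union hS₃fin
  -- ### Step D: Čebotarev in `Γ_ℚ`: a Frobenius in the open set `c₀ · res(ρ 𝒩)`
  set 𝒩 := evalKer (W.baseChange K) ((p ^ M : ℕ) : ℤ) cs with h𝒩
  have h𝒩open : IsOpen (𝒩 : Set (absoluteGaloisGroup K)) :=
    isOpen_evalKer (W.baseChange K) _ cs (isOpen_torsionFixing (W.baseChange K) hn0)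
  set O : Set (absoluteGaloisGroup ℚ) :=
    (fun γ ↦ c₀ * γ) '' (absGaloisRestrict ℚ K '' ((fun m ↦ ρ * m) '' (𝒩 : Set _))) with hO
  have hOopen : IsOpen O := by
    refine (Homeomorph.mulLeft c₀).isOpenMap _ (isOpenMap_absGaloisRestrict K _ ?_)
    exact (Homeomorph.mulLeft ρ).isOpenMap _ h𝒩open
  have hOne : O.Nonempty :=
    ⟨c₀ * absGaloisRestrict ℚ K (ρ * 1), _, ⟨_, ⟨1, 𝒩.one_mem, rfl⟩, rfl⟩, rfl⟩
  obtain ⟨γ, hγO, v, hvS, 𝔓₀, h𝔓₀, hγ⟩ :=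
    (absoluteGaloisGroup.frobenius_dense hC ℚ S hSfin).inter_open_nonempty O hOopen hOne
  obtain ⟨_, ⟨_, ⟨m, hm, rfl⟩, rfl⟩, rfl⟩ := hγO
  set g := ρ * m with hg
  have hgT : g ∈ torsionFixing (W.baseChange K) ((p ^ M : ℕ) : ℤ) := mul_mem hρT hm.1
  -- ### Step E: the rational prime `ℓ` under `v`
  obtain ⟨ℓ, hℓ, hℓv⟩ := exists_prime_natCast_mem v
  have hℓB : ℓ ∉ B := fun h ↦ hvS (Or.inl (Or.inl ⟨ℓ, h, hℓ, hℓv⟩))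
  simp only [hB, Finset.mem_union, Finset.mem_singleton, Nat.mem_primeFactors,
    Finset.mem_range, not_or] at hℓB
  obtain ⟨⟨⟨hℓp, hℓN⟩, hℓD⟩, hℓb⟩ := hℓB
  have hℓN' : ¬ ℓ ∣ N := fun h ↦ hℓN ⟨hℓ, h, NeZero.ne N⟩
  have hℓD' : ¬ ((ℓ : ℤ) ∣ NumberField.discr K) := fun h ↦
    hℓD ⟨hℓ, Int.natAbs_dvd_natAbs.mpr h |>.trans (by simp), by
      simp [NumberField.discr_ne_zero]⟩
  have hbℓ : b < ℓ := by omega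
  have hunr : Algebra.IsUnramifiedIn (𝓞 K) v.asIdeal := by
    by_contra h; exact hvS (Or.inl (Or.inr h))
  have hvS₃ : v ∉ S₃ := fun h ↦ hvS (Or.inr h)
  -- ### Step F: `ℓ` is inert, with a Frobenius `τ' = g^τ g` over `K`
  have hHi := index_range_absGaloisRestrict_eq_finrank ℚ K
  haveI hHn : ((absGaloisRestrict ℚ K).range).Normal :=
    Subgroup.normal_of_index_eq_two (hHi.trans hK.1)
  have hI := inertia_le_range_absGaloisRestrict_of_isUnramifiedIn (K := K) hunr h𝔓₀
  have hΦH : c₀ * absGaloisRestrict ℚ K g ∉ (absGaloisRestrict ℚ K).range := by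
    intro h
    apply hc₀.not_mem_range_absGaloisRestrict (L := K) IsTotallyComplex.isComplex
    change c₀ ∈ ((absGaloisRestrict ℚ K).range : Set (absoluteGaloisGroup ℚ))
    have h' : c₀ = c₀ * absGaloisRestrict ℚ K g * (absGaloisRestrict ℚ K g)⁻¹ := by group
    rw [SetLike.mem_coe, h']
    exact Subgroup.mul_mem _ h (Subgroup.inv_mem _ ⟨g, rfl⟩)
  obtain ⟨w, 𝔔, τ', hwv, hwuniq, -, h𝔔w, -, hτ', hresτ'⟩ :=
    exists_place_inert_of_not_mem_range (F := ℚ) (M := K) (hK.1 ▸ Nat.prime_two) hHn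
      (hHi.trans rfl) hunr h𝔓₀ hI hγ hΦH
  rw [hK.1, sq_eq_absGaloisRestrict_conjGal_mul hc₀ ht g] at hresτ'
  have hτ'eq : τ' = ht.conjGalCMH g * g := absGaloisRestrict_injective ℚ K hresτ'
  -- `ℓ ∈ w`, and `w` is the only place of `K` containing `ℓ`
  have hℓw : (ℓ : 𝓞 K) ∈ w.asIdeal := by
    have h1 : (ℓ : 𝓞 ℚ) ∈ (w.under (𝓞 ℚ)).asIdeal := by rw [hwv]; exact hℓv
    rw [HeightOneSpectrum.under_asIdeal, Ideal.under_def, Ideal.mem_comap, map_natCast] at h1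
    exact h1
  have hwuniq' : ∀ w' : HeightOneSpectrum (𝓞 K), (ℓ : 𝓞 K) ∈ w'.asIdeal → w' = w := by
    intro w' hw'
    apply hwuniq
    apply HeightOneSpectrum.eq_of_natCast_mem_rat hℓ _ hℓv
    rw [HeightOneSpectrum.under_asIdeal, Ideal.under_def, Ideal.mem_comap, map_natCast]
    exact hw'
  -- `(ℓ) = w` is prime
  have hspan : Ideal.span {(ℓ : 𝓞 K)} = w.asIdeal := by
    apply span_natCast_eq_of_unique hℓ w hwuniq'
    haveI : w.asIdeal.LiesOver v.asIdeal := ⟨by rw [← hwv]; rfl⟩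
    have hmap : v.asIdeal.map (algebraMap (𝓞 ℚ) (𝓞 K)) = Ideal.span {(ℓ : 𝓞 K)} := by
      rw [← span_natCast_rat_eq hℓ hℓv, Ideal.map_span, Set.image_singleton, map_natCast]
    have hne : v.asIdeal.map (algebraMap (𝓞 ℚ) (𝓞 K)) ≠ ⊥ := by
      rw [hmap, Ne, Ideal.span_singleton_eq_bot]; exact_mod_cast hℓ.ne_zero
    rw [← hmap, ← Ideal.IsDedekindDomain.ramificationIdx_eq_normalizedFactors_count v.asIdeal
      w.asIdeal hne]
    exact Ideal.ramificationIdx_eq_one_iff.mpr (hunr w.asIdeal w.isPrime inferInstance)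
  -- ### Step G: the local criterion at `w`, for the classes `p^a c_i`
  have hloc : ∀ i (a : ℕ), (((p : ℤ) ^ a) • cs i ∈
      (W.baseChange K).torsionLocalKer (w.adicCompletion K) ((p ^ M : ℕ) : ℤ) ↔
        ((p : ℤ) ^ a) • h1Eval (W.baseChange K) ((p ^ M : ℕ) : ℤ) (cs i)
          (ht.conjGalCMH (ρ * m) * (ρ * m)) = 0) := by
    intro i a
    haveI : CharZero (w.adicCompletion K) :=
      charZero_of_injective_algebraMap (algebraMap K (w.adicCompletion K)).injective
    obtain ⟨𝔐, h𝔐⟩ := w.localPrimesAbove_nonempty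
    set 𝔓w := w.primeBelow (closureEmb (K := K) (w.adicCompletion K)) 𝔐 with h𝔓w_def
    have h𝔓w : 𝔓w ∈ w.primesAbove := w.primeBelow_mem_primesAbove h𝔐
    obtain ⟨δ, hδ, hF⟩ :=
      HeightOneSpectrum.exists_isArithFrobAt_conj_of_mem_primesAbove_holds h𝔔w h𝔓w hτ'
    have hτ'T : τ' ∈ torsionFixing (W.baseChange K) ((p ^ M : ℕ) : ℤ) := by
      rw [hτ'eq]; exact mul_mem (ht.conjGalCMH_mem_torsionFixing W hinv _ hgT) hgT
    have hFT : δ * τ' * δ⁻¹ ∈ torsionFixing (W.baseChange K) ((p ^ M : ℕ) : ℤ) :=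
      (torsionFixing_normal (W.baseChange K) _).conj_mem _ hτ'T δ
    have hwbad : w ∉ (W.baseChange K).badPlaces (𝓞 K) := fun h ↦
      hvS₃ ⟨w, Or.inl h, hwv⟩
    have hwT : w ∉ T i := fun h ↦ hvS₃ ⟨w, Or.inr (Set.mem_iUnion.mpr ⟨i, h⟩), hwv⟩
    have hpw : ((p : ℤ) : 𝓞 K) ∉ w.asIdeal := by
      rw [Int.cast_natCast]
      exact not_natCast_mem_of_prime_ne hℓ hp hℓp w hℓw
    have hpMw : ((((p ^ M : ℕ) : ℤ)) : 𝓞 K) ∉ w.asIdeal := fun h ↦ by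
      apply hpw
      rw [Int.cast_natCast, Nat.cast_pow] at h
      rw [Int.cast_natCast]
      exact w.isPrime.mem_of_pow_mem M h
    have hcrit := mem_torsionLocalKer_iff_h1Eval_eq_zero (W.baseChange K) ((p ^ M : ℕ) : ℤ) h𝔐 hF
      hFT (inertia_le_torsionFixing (W.baseChange K) hwbad hpMw _ h𝔐)
      (isOpen_torsionFixing (W.baseChange K) hn0)
      (torsionPointsMap_bijective (W.baseChange K) (w.adicCompletion K)
        (pow_ne_zero M hp.ne_zero)).2
      (AddSubgroup.zsmul_mem _ (hT i w hwT 𝔓w h𝔓w) ((p : ℤ) ^ a))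
    rw [hcrit, h1Eval_conj (W.baseChange K) _ _ δ hτ'T, smul_eq_zero_iff_eq,
      h1Eval_zsmul (W.baseChange K) _ _ _ hτ'T, hτ'eq]
  -- ### Step H: assemble
  refine ⟨ℓ, hbℓ, hℓ, hℓN', hℓD', hℓp, hspan ▸ w.isPrime, ?_, fun i v' hv' ↦ ?_⟩
  · -- Cor. 3.2 (1): `γ = c₀ · res g` acts on `E(ℚ̄)[p^M]` and on `K` as `c₀`
    refine ⟨v, 𝔓₀, c₀ * absGaloisRestrict ℚ K g, c₀, hℓv, h𝔓₀, hγ, hc₀, fun P ↦ ?_, fun e x ↦ ?_⟩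
    · rw [mul_smul, absGaloisRestrict_smul_eq_of_mem_torsionFixing W hgT]
    · rw [mul_smul, absGaloisRestrict_smul_apply_eq g e x]
  · rw [hwuniq' v' hv']
    refine ⟨(hloc i (Nv i)).mpr (hρ m hm i).1, fun hN h ↦ (hρ m hm i).2 hN ((hloc i _).mp h)⟩

/-- **McCallum's Corollary 3.2 at level `p^M` from the image inputs**, with the printed
hypotheses (non-zero classes `c_i ∈ H¹(K, E[p^M])^±`, *"any relation `a₁c₁ + ⋯ + a_rc_r = 0`
implies that `ord c_i` divides `a_i`"*, `N_i ≤ M_i` where `p^{M_i} = ord c_i`): infinitely many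
(one above each bound) Kolyvagin primes `ℓ` (`IsKolyvaginPrime N W K p ℓ`) with
`Frob(ℓ) = Frob(∞)` in `Gal(K(E_{p^M})/ℚ)` and `ord c_{i,λ} = p^{N_i}`.  The tree's
`McCallum1991_cor_3_2_pow_of_chebotarev` with `ρ̄_{E,p}` onto replaced by `hz`, `hS`, `hCe`
(wrapper verbatim). [cite: McCallumLMS1991, §3 Cor. 3.2] -/
theorem McCallum1991_cor_3_2_pow_of_image (hC : Automorphic.chebotarev_artinRep) {N : ℕ}
    [NeZero N] [W.IsElliptic] (hK : IsImaginaryQuadratic K) {p : ℕ} (hp : p.Prime) (hp2 : p ≠ 2)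
    (hz : ∃ z : absoluteGaloisGroup K, ∀ t : geomTorsion (W.baseChange K) p, z • t = -t)
    (hS : (W.baseChange K).HasIrreducibleModPGaloisRep p)
    (hCe : ∀ f : geomTorsion (W.baseChange K) p →+ geomTorsion (W.baseChange K) p,
      (∀ (g : absoluteGaloisGroup K) (t : geomTorsion (W.baseChange K) p), f (g • t) = g • f t) →
        ∃ k : ℤ, ∀ t, f t = k • t)
    (hW : W.exists_weilPairing p) {M : ℕ} (hM : 1 ≤ M)
    {c : K ≃ₐ[ℚ] K} (hc : c ≠ 1) {r : ℕ}
    (cs : Fin r → galH1Torsion (W.baseChange K) ((p ^ M : ℕ) : ℤ)) (h0 : ∀ i, cs i ≠ 0)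
    (Nv : Fin r → ℕ) (hN : ∀ i, Nv i ≠ 0 → ((p : ℤ) ^ (Nv i - 1)) • cs i ≠ 0)
    (hτ : ∀ i, ∃ e : ℤ, (e = 1 ∨ e = -1) ∧ conjAct W c ((p ^ M : ℕ) : ℤ) (cs i) = e • cs i)
    (hind : ∀ a : Fin r → ℤ, ∑ i, a i • cs i = 0 → ∀ i, a i • cs i = 0) (b : ℕ) :
    ∃ ℓ : ℕ, b < ℓ ∧ IsKolyvaginPrime N W K p ℓ ∧ FrobEqFrobInfty W K (p ^ M) ℓ ∧
      ∀ i, ∀ v : HeightOneSpectrum (𝓞 K), (ℓ : 𝓞 K) ∈ v.asIdeal →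
        (((p : ℤ) ^ Nv i) • cs i ∈
            (W.baseChange K).torsionLocalKer (v.adicCompletion K) ((p ^ M : ℕ) : ℤ) ∧
          (Nv i ≠ 0 → ((p : ℤ) ^ (Nv i - 1)) • cs i ∉
            (W.baseChange K).torsionLocalKer (v.adicCompletion K) ((p ^ M : ℕ) : ℤ))) := by
  -- exponents `p^{e_i} = ord c_i`
  choose ex hex1 hexM hex hexmin hord using fun i ↦
    exists_addOrderOf_eq_pow (W.baseChange K) hp M (hx := h0 i)
  have hind' : ∀ a : Fin r → ℤ, ∑ i, a i • cs i = 0 → ∀ i, ((p : ℤ) ^ ex i) ∣ a i := by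
    intro a ha i
    have h := (addOrderOf_dvd_iff_zsmul_eq_zero).mpr (hind a ha i)
    rwa [hord i, Nat.cast_pow] at h
  have hNe : ∀ i, Nv i ≤ ex i := fun i ↦ by
    by_contra hlt
    have hlt := Nat.lt_of_not_le hlt
    have hk : ((p : ℤ) ^ (Nv i - 1)) • cs i = 0 := by
      have : Nv i - 1 = (Nv i - 1 - ex i) + ex i := by omega
      rw [this, pow_add, mul_smul, hex i]
      exact zsmul_zero _
    exact hN i (by omega) hk
  have hNM : ∀ i, Nv i ≤ M := fun i ↦ (hNe i).trans (hexM i)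
  obtain ⟨ℓ, hbℓ, hℓ, hℓN, hℓD, hℓp, hprime, hfrob, hloc⟩ :=
    exists_kolyvaginPrime_gt_pow_of_image (N := N) hC hK hp hp2 hz hS hCe hW hM hc cs hτ ex hex
      hind' Nv hNe hNM b
  exact ⟨ℓ, hbℓ, ⟨hℓ, hℓN, hℓD, hℓp, hprime, hfrob.of_dvd (dvd_pow_self p (by omega))⟩, hfrob, hloc⟩

end Main

/-! ## §2. At `p = 3` for every irreducible `E[3]`, on the locus of crux 19616 — unconditional -/

section Three

open Summit.BirchSwinnertonDyer.BirchSwinnertonDyer.Theorems.ShimuraKolyvaginImageInputs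

variable (W : WeierstrassCurve ℚ) [W.IsElliptic] (K : Type u) [Field K] [NumberField K]

/-- **McCallum's Cor. 3.2 at `p = 3`, every level `3^M`, for EVERY irreducible `E[3]` — onto or
not — under the hypotheses of the registered stub `stub_orderBound_irredNonSurjAtThree` of item
19616** (`N_E = N`, `E[3]` irreducible, `K` imaginary quadratic, the primes of `S` (`N⁻ = ∏ S`)
unramified in `K`, the other primes of `N` and `3` split).  Given the complex conjugation `c` of
`K`, non-zero `c`-eigenclasses `c_i ∈ H¹(K, E[3^M])` with McCallum's independence and exponents
`N_i` with `3^{N_i - 1} c_i ≠ 0`: above every bound there is a Kolyvagin prime `ℓ`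
(`IsKolyvaginPrime N W K 3 ℓ`: `ℓ ∤ N d_K`, `ℓ ≠ 3`, `(ℓ)` inert, `Frob(ℓ) = Frob(∞)` on `E[3]`)
with `Frob(ℓ) = Frob(∞)` in `Gal(K(E_{3^M})/ℚ)` and `ord c_{i,λ} = 3^{N_i}` at `λ ∋ ℓ`.
UNCONDITIONAL: image inputs from `kolyvaginImageInputs_three` (Gross's disjointness
`(d_K, 3N) = 1`, seat g3's `−1 ∈ ρ̄(Γ_K)`), Weil pairing `exists_weilPairing_holds`, Čebotarev
`Automorphic.chebotarev_artinRep_of_galoisSide` — all PROVED in the tree.  The image-uniformity of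
the Čebotarev step printed by Matar–Nekovář (Prop. 5.26 (2)) and Cha (Lemmas 22–23), in the kernel
at `p = 3`. [cite: McCallumLMS1991, §3 Cor. 3.2]
[cite: MatarNekovar2019, Prop. 5.26 (2)] [cite: Cha2005, Lemmas 22–23] -/
theorem McCallum1991_cor_3_2_pow_three_of_irr {N : ℕ} [NeZero N] (S : Finset ℕ)
    (hN : W.conductorNorm ℤ = N) (hirr : W.HasIrreducibleModPGaloisRep 3)
    (hK : IsImaginaryQuadratic K)
    (hS : ∀ ℓ ∈ S, ℓ.Prime ∧ ℓ ∣ N ∧ ¬ ℓ ^ 2 ∣ N ∧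
      ((Ideal.span {(ℓ : ℤ)}).primesOver (𝓞 K)).ncard = 1 ∧ ¬ (ℓ : ℤ) ∣ NumberField.discr K)
    (hsplit : ∀ ℓ : ℕ, ℓ.Prime → ℓ ∣ N → ℓ ∉ S →
      ((Ideal.span {(ℓ : ℤ)}).primesOver (𝓞 K)).ncard = 2)
    (h3 : ((Ideal.span {((3 : ℕ) : ℤ)}).primesOver (𝓞 K)).ncard = 2) {M : ℕ} (hM : 1 ≤ M)
    {c : K ≃ₐ[ℚ] K} (hc : c ≠ 1) {r : ℕ}
    (cs : Fin r → galH1Torsion (W.baseChange K) ((3 ^ M : ℕ) : ℤ)) (h0 : ∀ i, cs i ≠ 0)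
    (Nv : Fin r → ℕ) (hNv : ∀ i, Nv i ≠ 0 → ((3 : ℤ) ^ (Nv i - 1)) • cs i ≠ 0)
    (hτ : ∀ i, ∃ e : ℤ, (e = 1 ∨ e = -1) ∧ conjAct W c ((3 ^ M : ℕ) : ℤ) (cs i) = e • cs i)
    (hind : ∀ a : Fin r → ℤ, ∑ i, a i • cs i = 0 → ∀ i, a i • cs i = 0) (b : ℕ) :
    ∃ ℓ : ℕ, b < ℓ ∧ IsKolyvaginPrime N W K 3 ℓ ∧ FrobEqFrobInfty W K (3 ^ M) ℓ ∧
      ∀ i, ∀ v : HeightOneSpectrum (𝓞 K), (ℓ : 𝓞 K) ∈ v.asIdeal →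
        (((3 : ℤ) ^ Nv i) • cs i ∈
            (W.baseChange K).torsionLocalKer (v.adicCompletion K) ((3 ^ M : ℕ) : ℤ) ∧
          (Nv i ≠ 0 → ((3 : ℤ) ^ (Nv i - 1)) • cs i ∉
            (W.baseChange K).torsionLocalKer (v.adicCompletion K) ((3 ^ M : ℕ) : ℤ))) := by
  haveI : Fact (Nat.Prime 3) := ⟨Nat.prime_three⟩
  obtain ⟨-, hSimple, hCe, -, -⟩ :=
    kolyvaginImageInputs_three K W S hN hirr hK hS hsplit h3 (M := 1) le_rfl
  have hz1 : ∃ z : absoluteGaloisGroup K, ∀ t : geomTorsion (W.baseChange K) ((3 : ℕ) : ℤ),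
      z • t = -t :=
    ShimuraKolyvaginImageOverK.exists_smul_eq_neg_three_of_irr_of_finrank_eq_two W K hK.1 hirr
  exact McCallum1991_cor_3_2_pow_of_image (W := W) Automorphic.chebotarev_artinRep_of_galoisSide
    hK Nat.prime_three (by decide) hz1 hSimple hCe (W.exists_weilPairing_holds 3) hM hc cs h0 Nv
    hNv hτ hind b

end Three

end Summit.BirchSwinnertonDyer.BirchSwinnertonDyer.Theorems.ShimuraKolyvaginCebotarevOfImage

end
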